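import Literature.AlgebraicGeometry.Motives.HodgeStructureLefschetzGroupIsotypicBlock
import HarnessLib

/-!
# «`C(A)`, AS A `k`-ALGEBRA WITH INVOLUTION, DEPENDS ONLY ON THE ISOGENY CLASS OF `A` (UP TO A CANONICAL ISOMORPHISM)» and
# «`S(A)` … (UP TO A UNIQUE ISOMORPHISM)», READ ON ISOMORPHISMS OF HODGE STRUCTURES: a bijective morphism `g : H₁ ⥲ H₂` induces
# `C(H₁) ≃ₐ C(H₂)`, `c ↦ g c g⁻¹`, compatible with the adjoints of ANY polarizations, and the induced maps on `C` and on
# `S(ℚ)` do not depend on the choice of `g` (Milne 1999 §1 pp. 643–644)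

[topic AlgebraicGeometry/Motives]

Layer `Literature/AlgebraicGeometry/Motives`, lane `lit-hodgefound` (Track 2 foundations library; prover seat
`lit-hodgefound-p02`, generation 52, self-proposed row g52-#8). THEOREMS ONLY: no definition, no named fact (net debt `0`),
no instance, no notation.  p34's `Motives/HodgeStructureLefschetzGroupTransport` proves all of this for the TRANSPORT
`e : e^* H ⥲ H` along a linear equivalence (`centralizerEndAlgComapEquivAlgEquiv`, `conjAlgEquiv_eq_of_comapEquiv_eq` «independent
of the choice of `α`», `symm_trans_trans_eq_of_comapEquiv_eq` «up to a unique isomorphism», `Polarization.conjAlgEquiv_adjoint_comapEquiv`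
«with involution»); this file reads the statements on bijective MORPHISMS `g : H₁ → H₂` between two given Hodge structures with
their own polarizations, through g52-#5's `eq_comapEquiv_of_hom_bijective` (`H₁ = g^* H₂`) and the polarization-independence of
the adjoint on `C` (p34 `Polarization.adjoint_eq_adjoint_of_mem_centralizer_endAlg`, its `HodgeTensorFacts` hypothesis discharged
by `hodgeTensorFacts_holds`).  g52-#5 ∕ #6 gave only `Nonempty (C(H₁) ≃ₐ C(H₂))` and `S(H₁, Q₁)(ℚ) ≃* S(H₂, Q₂)(ℚ)`; here the
isomorphisms get their formula, their uniqueness and their compatibility with `†`.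

## The source, verbatim

J. S. Milne, *Lefschetz classes on abelian varieties*, Duke Math. J. 96 (1999) 639–675 [Milne1999LefschetzClasses] (held
`paper:doi-10-1215-s0012-7094-99-09620-5`), §1 p. 643 L5–L11: "Then `C(A)` is a `k`-algebra stable under the involution `†`
defined by an ample divisor `D`, and the restriction of `†` to `C(A)` is independent of the choice of `D`. An isogeny `α : A → B`
defines an isomorphism `γ ↦ V(α) ∘ γ ∘ V(α)⁻¹ : C(A) → C(B)` of `k`-algebras with involution, which is independent of the choice
of `α`. Therefore `C(A)`, as a `k`-algebra with involution, depends only on the isogeny class of `A` (up to a canonical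
isomorphism)."; p. 644 L20–L21: "Clearly `S(A)` depends only on the isogeny class of `A` (up to a unique isomorphism)."
Also C. Voisin [VoisinHodgeI2002] §7.3.1 Lemma 7.23 (the inverse of a bijective morphism is a morphism), D. Huybrechts
[Huybrechts2016K3] Ch. 3 §3.3.5 eq. (3.3) (the adjoint `⟨a v, w⟩ = ⟨v, a' w⟩`).

## Dictionary and what is proved (namespace `Literature.AlgebraicGeometry.Motives.HodgeStructure`)

`C(H) = Subalgebra.centralizer ℚ E_φ(H)`, `†_Q = Q.adjoint`, `S(H, Q)(ℚ) = Q.lefschetzGroup`; `g : Hom H₁ H₂` bijective with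
underlying linear equivalence `e_g = LinearEquiv.ofBijective g.toLinearMap hg`; "a map `e : C(H₁) → C(H₂)` lies over `g`" =
`∀ c v, (e c) (g v) = g (c v)`, i.e. `e c = g ∘ c ∘ g⁻¹`.

* §1 **`exists_centralizer_endAlg_algEquiv_of_hom_bijective`** («defines an isomorphism `γ ↦ V(α) ∘ γ ∘ V(α)⁻¹ : C(A) → C(B)`»:
  an algebra isomorphism over `g` exists), `coe_eq_conjAlgEquiv_of_forall_apply_hom_apply` (a map over `g` is `c ↦ e_g c e_g⁻¹`),
  **`conjAlgEquiv_ofBijective_eq_of_mem_centralizer_endAlg`** («independent of the choice of `α`»: `e_g c e_g⁻¹ = e_{g'} c e_{g'}⁻¹`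
  for `c ∈ C(H₁)` and any two Hodge isomorphisms `g, g'`), **`centralizer_map_eq_of_forall_apply_hom_apply`** («up to a canonical
  isomorphism»: maps over `g` and over `g'` coincide).
* §2 `Polarization.adjoint_eq_adjoint_of_hodgeStructure_eq_of_mem_centralizer` (equal Hodge structures on one carrier: the same `†`
  on `C`, any polarizations), **`Polarization.coe_map_adjoint_eq_adjoint_of_forall_apply_hom_apply`** («of `k`-algebras with
  involution»: a map over `g` carries `†_{Q₁}` to `†_{Q₂}` for ANY polarizations `Q₁` of `H₁`, `Q₂` of `H₂`),
  **`Polarization.exists_centralizer_endAlg_algEquiv_adjoint_of_hom_bijective`** (packaged).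
* §3 **`Polarization.lefschetzGroup_map_eq_of_forall_apply_hom_apply`** («up to a unique isomorphism» for `S`: maps
  `S(H₁, Q₁)(ℚ) → S(H₂, Q₂)(ℚ)` over `g` and over `g'` coincide).
-/

noncomputable section

namespace Literature.AlgebraicGeometry.Motives

namespace HodgeStructure

universe u

variable {n : ℤ} {V W : Type u} [AddCommGroup V] [Module ℚ V] [AddCommGroup W] [Module ℚ W]
  {H₁ : HodgeStructure V n} {H₂ : HodgeStructure W n}

/-! ## §1 «`γ ↦ V(α) ∘ γ ∘ V(α)⁻¹ : C(A) → C(B)` … independent of the choice of `α`» -/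

/-- **«An isogeny `α : A → B` defines an isomorphism `γ ↦ V(α) ∘ γ ∘ V(α)⁻¹ : C(A) → C(B)`»**: a bijective morphism of Hodge
structures `g : H₁ ⥲ H₂` induces an isomorphism of `ℚ`-algebras `e : C(H₁) ≃ₐ[ℚ] C(H₂)` LYING OVER `g`, `(e c) (g v) = g (c v)`
(`H₁ = g^* H₂`, g52-#5, and p34's transport `C(g^* H₂) ≃ₐ C(H₂)`). [cite: Milne1999LefschetzClasses, §1 p. 643 L7–L8]
[cite: VoisinHodgeI2002, §7.3.1 Lemma 7.23] -/
theorem exists_centralizer_endAlg_algEquiv_of_hom_bijective (g : Hom H₁ H₂) (hg : Function.Bijective g.toLinearMap) :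
    ∃ e : Subalgebra.centralizer ℚ (H₁.endAlg : Set (Module.End ℚ V)) ≃ₐ[ℚ]
        Subalgebra.centralizer ℚ (H₂.endAlg : Set (Module.End ℚ W)),
      ∀ (c : Subalgebra.centralizer ℚ (H₁.endAlg : Set (Module.End ℚ V))) (v : V),
        ((e c : Subalgebra.centralizer ℚ (H₂.endAlg : Set (Module.End ℚ W))) : Module.End ℚ W) (g.toLinearMap v) =
          g.toLinearMap ((c : Module.End ℚ V) v) := by
  have h := eq_comapEquiv_of_hom_bijective g hg
  have hC : Subalgebra.centralizer ℚ (H₁.endAlg : Set (Module.End ℚ V)) =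
      Subalgebra.centralizer ℚ ((H₂.comapEquiv (LinearEquiv.ofBijective g.toLinearMap hg)).endAlg :
        Set (Module.End ℚ V)) := by
    rw [← h]
  refine ⟨(Subalgebra.equivOfEq _ _ hC).trans
    (centralizerEndAlgComapEquivAlgEquiv H₂ (LinearEquiv.ofBijective g.toLinearMap hg)), fun c v => ?_⟩
  rw [AlgEquiv.trans_apply, centralizerEndAlgComapEquivAlgEquiv_apply_apply]
  change (LinearEquiv.ofBijective g.toLinearMap hg) ((c : Module.End ℚ V)
    ((LinearEquiv.ofBijective g.toLinearMap hg).symm ((LinearEquiv.ofBijective g.toLinearMap hg) v))) = _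
  rw [LinearEquiv.symm_apply_apply]
  rfl

/-- A map `e : C(H₁) → C(H₂)` lying over a bijective morphism `g` is conjugation by the underlying linear equivalence `e_g`:
`e c = e_g ∘ c ∘ e_g⁻¹`. [cite: Milne1999LefschetzClasses, §1 p. 643 L7–L8] -/
theorem coe_eq_conjAlgEquiv_of_forall_apply_hom_apply (g : Hom H₁ H₂) (hg : Function.Bijective g.toLinearMap)
    (e : Subalgebra.centralizer ℚ (H₁.endAlg : Set (Module.End ℚ V)) →
      Subalgebra.centralizer ℚ (H₂.endAlg : Set (Module.End ℚ W)))
    (he : ∀ (c : Subalgebra.centralizer ℚ (H₁.endAlg : Set (Module.End ℚ V))) (v : V),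
      ((e c : Subalgebra.centralizer ℚ (H₂.endAlg : Set (Module.End ℚ W))) : Module.End ℚ W) (g.toLinearMap v) =
        g.toLinearMap ((c : Module.End ℚ V) v))
    (c : Subalgebra.centralizer ℚ (H₁.endAlg : Set (Module.End ℚ V))) :
    ((e c : Subalgebra.centralizer ℚ (H₂.endAlg : Set (Module.End ℚ W))) : Module.End ℚ W) =
      (LinearEquiv.ofBijective g.toLinearMap hg).conjAlgEquiv ℚ (c : Module.End ℚ V) := by
  refine LinearMap.ext fun w => ?_
  obtain ⟨v, rfl⟩ := hg.2 w
  rw [he c v, LinearEquiv.conjAlgEquiv_apply, LinearMap.comp_apply, LinearMap.comp_apply, LinearEquiv.coe_coe,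
    LinearEquiv.coe_coe]
  change _ = (LinearEquiv.ofBijective g.toLinearMap hg) ((c : Module.End ℚ V)
    ((LinearEquiv.ofBijective g.toLinearMap hg).symm ((LinearEquiv.ofBijective g.toLinearMap hg) v)))
  rw [LinearEquiv.symm_apply_apply]
  rfl

/-- **«which is independent of the choice of `α`»**: for two bijective morphisms `g, g' : H₁ ⥲ H₂` and `c ∈ C(H₁)`,
`e_g c e_g⁻¹ = e_{g'} c e_{g'}⁻¹` — `e_{g'} e_g⁻¹` is an automorphism of `H₂`, hence in `E_φ(H₂)`, and commutes with `e_g c e_g⁻¹ ∈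
C(H₂)` (p34's `conjAlgEquiv_eq_of_comapEquiv_eq` for `g^* H₂ = H₁ = g'^* H₂`). [cite: Milne1999LefschetzClasses, §1 p. 643 L7–L9] -/
theorem conjAlgEquiv_ofBijective_eq_of_mem_centralizer_endAlg (g g' : Hom H₁ H₂) (hg : Function.Bijective g.toLinearMap)
    (hg' : Function.Bijective g'.toLinearMap) {c : Module.End ℚ V}
    (hc : c ∈ Subalgebra.centralizer ℚ (H₁.endAlg : Set (Module.End ℚ V))) :
    (LinearEquiv.ofBijective g.toLinearMap hg).conjAlgEquiv ℚ c =
      (LinearEquiv.ofBijective g'.toLinearMap hg').conjAlgEquiv ℚ c := by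
  have h := eq_comapEquiv_of_hom_bijective g hg
  have h' := eq_comapEquiv_of_hom_bijective g' hg'
  rw [h] at hc
  exact (conjAlgEquiv_eq_of_comapEquiv_eq H₂ (h.symm.trans h') hc).symm

/-- **«up to a canonical isomorphism»**: two maps `e, e' : C(H₁) → C(H₂)` lying over bijective morphisms `g`, `g'` respectively
COINCIDE; in particular the isomorphism of `exists_centralizer_endAlg_algEquiv_of_hom_bijective` is unique and does not depend on
`g`. [cite: Milne1999LefschetzClasses, §1 p. 643 L9–L11] -/
theorem centralizer_map_eq_of_forall_apply_hom_apply (g g' : Hom H₁ H₂) (hg : Function.Bijective g.toLinearMap)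
    (hg' : Function.Bijective g'.toLinearMap)
    (e e' : Subalgebra.centralizer ℚ (H₁.endAlg : Set (Module.End ℚ V)) →
      Subalgebra.centralizer ℚ (H₂.endAlg : Set (Module.End ℚ W)))
    (he : ∀ (c : Subalgebra.centralizer ℚ (H₁.endAlg : Set (Module.End ℚ V))) (v : V),
      ((e c : Subalgebra.centralizer ℚ (H₂.endAlg : Set (Module.End ℚ W))) : Module.End ℚ W) (g.toLinearMap v) =
        g.toLinearMap ((c : Module.End ℚ V) v))
    (he' : ∀ (c : Subalgebra.centralizer ℚ (H₁.endAlg : Set (Module.End ℚ V))) (v : V),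
      ((e' c : Subalgebra.centralizer ℚ (H₂.endAlg : Set (Module.End ℚ W))) : Module.End ℚ W) (g'.toLinearMap v) =
        g'.toLinearMap ((c : Module.End ℚ V) v)) :
    e = e' := by
  refine funext fun c => Subtype.ext ?_
  rw [coe_eq_conjAlgEquiv_of_forall_apply_hom_apply g hg e he c, coe_eq_conjAlgEquiv_of_forall_apply_hom_apply g' hg' e' he' c]
  exact conjAlgEquiv_ofBijective_eq_of_mem_centralizer_endAlg g g' hg hg' c.2

/-! ## §2 «of `k`-algebras with involution» — for ANY polarizations on the two sides -/

section Involution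

variable [Module.Finite ℚ V] [Module.Finite ℚ W]

omit [Module.Finite ℚ W] in
/-- Two (propositionally) equal Hodge structures on one carrier have the same involution `†` on `C` for ANY two polarizations
(«the restriction of `†` to `C(A)` is independent of the choice of `D`», p34's `adjoint_eq_adjoint_of_mem_centralizer_endAlg`, its
`HodgeTensorFacts` hypothesis discharged by `hodgeTensorFacts_holds`). [cite: Milne1999LefschetzClasses, §1 p. 643 L5–L6] -/
theorem Polarization.adjoint_eq_adjoint_of_hodgeStructure_eq_of_mem_centralizer {H H' : HodgeStructure V n} (h : H = H')
    (Q : Polarization H) (Q' : Polarization H') {c : Module.End ℚ V}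
    (hc : c ∈ Subalgebra.centralizer ℚ (H.endAlg : Set (Module.End ℚ V))) : Q.adjoint c = Q'.adjoint c := by
  subst h
  haveI : HodgeTensorFacts.{u, u} := hodgeTensorFacts_holds
  exact Q.adjoint_eq_adjoint_of_mem_centralizer_endAlg Q' hc

/-- **«an isomorphism … of `k`-algebras with involution»**: a map `e : C(H₁) → C(H₂)` lying over a bijective morphism `g`
carries the adjoint `†_{Q₁}` of ANY polarization `Q₁` of `H₁` to the adjoint `†_{Q₂}` of ANY polarization `Q₂` of `H₂`:
`e (c^{†₁}) = (e c)^{†₂}` (`e c = e_g c e_g⁻¹`; p34's transport of the adjoint `e_g (a^{†'}) e_g⁻¹ = (e_g a e_g⁻¹)^{†₂}` for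
`†'` the adjoint of `e_g^* Q₂`, and `†' = †₁` on `C(H₁)` by §2's independence). [cite: Milne1999LefschetzClasses, §1 p. 643 L5–L9]
[cite: Huybrechts2016K3, Ch. 3 §3.3.5 eq. (3.3)] -/
theorem Polarization.coe_map_adjoint_eq_adjoint_of_forall_apply_hom_apply (g : Hom H₁ H₂)
    (hg : Function.Bijective g.toLinearMap) (Q₁ : Polarization H₁) (Q₂ : Polarization H₂)
    (e : Subalgebra.centralizer ℚ (H₁.endAlg : Set (Module.End ℚ V)) →
      Subalgebra.centralizer ℚ (H₂.endAlg : Set (Module.End ℚ W)))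
    (he : ∀ (c : Subalgebra.centralizer ℚ (H₁.endAlg : Set (Module.End ℚ V))) (v : V),
      ((e c : Subalgebra.centralizer ℚ (H₂.endAlg : Set (Module.End ℚ W))) : Module.End ℚ W) (g.toLinearMap v) =
        g.toLinearMap ((c : Module.End ℚ V) v))
    (c : Subalgebra.centralizer ℚ (H₁.endAlg : Set (Module.End ℚ V))) :
    ((e ⟨Q₁.adjoint c, Q₁.adjoint_mem_centralizer_endAlg c.2⟩ :
        Subalgebra.centralizer ℚ (H₂.endAlg : Set (Module.End ℚ W))) : Module.End ℚ W) =
      Q₂.adjoint ((e c : Subalgebra.centralizer ℚ (H₂.endAlg : Set (Module.End ℚ W))) : Module.End ℚ W) := by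
  rw [coe_eq_conjAlgEquiv_of_forall_apply_hom_apply g hg e he, coe_eq_conjAlgEquiv_of_forall_apply_hom_apply g hg e he c]
  change (LinearEquiv.ofBijective g.toLinearMap hg).conjAlgEquiv ℚ (Q₁.adjoint (c : Module.End ℚ V)) = _
  rw [Polarization.adjoint_eq_adjoint_of_hodgeStructure_eq_of_mem_centralizer (eq_comapEquiv_of_hom_bijective g hg) Q₁
    (Q₂.comapEquiv (LinearEquiv.ofBijective g.toLinearMap hg)) c.2]
  exact Q₂.conjAlgEquiv_adjoint_comapEquiv (LinearEquiv.ofBijective g.toLinearMap hg) (c : Module.End ℚ V)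

/-- **«Therefore `C(A)`, as a `k`-algebra with involution, depends only on the isogeny class of `A`»**, packaged: a bijective
morphism `g : H₁ ⥲ H₂` induces `e : C(H₁) ≃ₐ[ℚ] C(H₂)` over `g` with `e (c^{†₁}) = (e c)^{†₂}` for ANY polarizations `Q₁`, `Q₂`
(unique and independent of `g` by §1). [cite: Milne1999LefschetzClasses, §1 p. 643 L5–L11] -/
theorem Polarization.exists_centralizer_endAlg_algEquiv_adjoint_of_hom_bijective (g : Hom H₁ H₂)
    (hg : Function.Bijective g.toLinearMap) (Q₁ : Polarization H₁) (Q₂ : Polarization H₂) :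
    ∃ e : Subalgebra.centralizer ℚ (H₁.endAlg : Set (Module.End ℚ V)) ≃ₐ[ℚ]
        Subalgebra.centralizer ℚ (H₂.endAlg : Set (Module.End ℚ W)),
      (∀ (c : Subalgebra.centralizer ℚ (H₁.endAlg : Set (Module.End ℚ V))) (v : V),
        ((e c : Subalgebra.centralizer ℚ (H₂.endAlg : Set (Module.End ℚ W))) : Module.End ℚ W) (g.toLinearMap v) =
          g.toLinearMap ((c : Module.End ℚ V) v)) ∧
      ∀ c : Subalgebra.centralizer ℚ (H₁.endAlg : Set (Module.End ℚ V)),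
        ((e ⟨Q₁.adjoint c, Q₁.adjoint_mem_centralizer_endAlg c.2⟩ :
            Subalgebra.centralizer ℚ (H₂.endAlg : Set (Module.End ℚ W))) : Module.End ℚ W) =
          Q₂.adjoint ((e c : Subalgebra.centralizer ℚ (H₂.endAlg : Set (Module.End ℚ W))) : Module.End ℚ W) := by
  obtain ⟨e, he⟩ := exists_centralizer_endAlg_algEquiv_of_hom_bijective g hg
  exact ⟨e, he, Q₁.coe_map_adjoint_eq_adjoint_of_forall_apply_hom_apply g hg Q₂ e he⟩

end Involution

/-! ## §3 «`S(A)` … up to a unique isomorphism» -/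

/-- **«Clearly `S(A)` depends only on the isogeny class of `A` (up to a unique isomorphism)»**: two maps
`r, r' : S(H₁, Q₁)(ℚ) → S(H₂, Q₂)(ℚ)` lying over bijective morphisms `g`, `g'` respectively (`(r γ) (g v) = g (γ v)`) COINCIDE —
`e_{g'} e_g⁻¹` is an automorphism of `H₂` and `e_g γ e_g⁻¹` commutes with `E_φ(H₂)` (p34's `symm_trans_trans_eq_of_comapEquiv_eq`); in
particular the isomorphism of g52-#6 `Polarization.exists_lefschetzGroup_mulEquiv_of_hom_bijective` is unique and independent of `g`.
[cite: Milne1999LefschetzClasses, §1 p. 644 L20–L21] -/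
theorem Polarization.lefschetzGroup_map_eq_of_forall_apply_hom_apply (g g' : Hom H₁ H₂)
    (hg : Function.Bijective g.toLinearMap) (hg' : Function.Bijective g'.toLinearMap) {Q₁ : Polarization H₁}
    {Q₂ : Polarization H₂} (r r' : Q₁.lefschetzGroup → Q₂.lefschetzGroup)
    (hr : ∀ (γ : Q₁.lefschetzGroup) (v : V), ((r γ : Q₂.lefschetzGroup) : W ≃ₗ[ℚ] W) (g.toLinearMap v) =
      g.toLinearMap ((γ : V ≃ₗ[ℚ] V) v))
    (hr' : ∀ (γ : Q₁.lefschetzGroup) (v : V), ((r' γ : Q₂.lefschetzGroup) : W ≃ₗ[ℚ] W) (g'.toLinearMap v) =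
      g'.toLinearMap ((γ : V ≃ₗ[ℚ] V) v)) :
    r = r' := by
  have h := eq_comapEquiv_of_hom_bijective g hg
  have h' := eq_comapEquiv_of_hom_bijective g' hg'
  -- a map over `g` is `γ ↦ e_g γ e_g⁻¹`
  have key : ∀ (g : Hom H₁ H₂) (hg : Function.Bijective g.toLinearMap) (r : Q₁.lefschetzGroup → Q₂.lefschetzGroup),
      (∀ (γ : Q₁.lefschetzGroup) (v : V), ((r γ : Q₂.lefschetzGroup) : W ≃ₗ[ℚ] W) (g.toLinearMap v) =
        g.toLinearMap ((γ : V ≃ₗ[ℚ] V) v)) → ∀ γ : Q₁.lefschetzGroup, ((r γ : Q₂.lefschetzGroup) : W ≃ₗ[ℚ] W) =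
          (LinearEquiv.ofBijective g.toLinearMap hg).symm.trans
            ((γ : V ≃ₗ[ℚ] V).trans (LinearEquiv.ofBijective g.toLinearMap hg)) := by
    intro g hg r hr γ
    refine LinearEquiv.ext fun w => ?_
    obtain ⟨v, rfl⟩ := hg.2 w
    rw [hr γ v, LinearEquiv.trans_apply, LinearEquiv.trans_apply]
    change _ = (LinearEquiv.ofBijective g.toLinearMap hg) ((γ : V ≃ₗ[ℚ] V)
      ((LinearEquiv.ofBijective g.toLinearMap hg).symm ((LinearEquiv.ofBijective g.toLinearMap hg) v)))
    rw [LinearEquiv.symm_apply_apply]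
    rfl
  refine funext fun γ => Subtype.ext ?_
  rw [key g hg r hr γ, key g' hg' r' hr' γ]
  have hγ : ∀ a : (H₂.comapEquiv (LinearEquiv.ofBijective g.toLinearMap hg)).endAlg, ∀ v,
      (a : Module.End ℚ V) ((γ : V ≃ₗ[ℚ] V) v) = (γ : V ≃ₗ[ℚ] V) ((a : Module.End ℚ V) v) := by
    rw [← h]
    exact γ.2.1
  exact (symm_trans_trans_eq_of_comapEquiv_eq (h.symm.trans h') hγ).symm

end HodgeStructure

end Literature.AlgebraicGeometry.Motives
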